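/-
Copyright (c) 2026. All rights reserved.
Released under Apache 2.0 license as described in the file LICENSE.
Authors: abc-iut cell, seat abc-iut-w5-d053 (gen 4; row «COR37-LOGOBS-GLUE») over abc-iut-L4-t5's assembly
(`BiAnabelianCompatibilityTelecore.lean`, `BiAnabelianCompatibilityShiftAssembly.lean`).
-/
import Literature.AnabelianGeometry.AbsoluteAnabelian.AbsTopIII.BiAnabelianLogGlueFamily
import Literature.AnabelianGeometry.AbsoluteAnabelian.AbsTopIII.BiAnabelianCompatibilityShiftAssembly
import HarnessLib

/-!
# [AbsTopIII] Cor 3.7 (iii), second clause — BOTH typed halves (cores AND telecore) under `ι` over Galois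

S. Mochizuki, *Topics in absolute anabelian geometry III* [MochizukiAbsTopIII2015] (kurims manuscript
`paper:url-5493eb38cbb7`), Cor 3.7 (iii) p. 88: the family of `𝔖†_log` "is compatible with the families of
homotopies that constitute the core and telecore structures of (i), (ii)" — typed by abc-iut-L4-t5 as
`LogObsCompatCoresStmt` and `LogObsCompatTelecoreStmt` (`BiAnabelianCompatibility.lean`).

PROOF-ONLY one-liners: the glued family `glueLogFamily hT hL` of `BiAnabelianLogGlueFamily.lean` contains
abc-iut-L4-t5's `K₁ = glueFamily` with the same homotopies (`glueFamily_sub_glueLogFamily`) and realises `𝔖†_log`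
(`realisesCoresAndLogObs_glueLogFamily`), so abc-iut-L4-t5's assembly (`logObsCompat_of_glueFamily_le`,
`realisesCoresLogObsTele_of_glueFamily_le`, over abc-iut-L4-t12's telecore `𝔗_δ = teleT θ` of a bi-anabelian lift
datum `θ`) yields the telecore half as well.  HONEST FRAMING: conditional on the displayed (H×)/(Hlog) and on a lift
datum `θ` (the telecore `𝔗_δ` is built from `θ`; at the full MLF model no `θ` exists — abc-iut-L4-t9 lineage's
`isEmpty_biAnabelianLift_modelSetting` — while the affine sub-models carry one); nothing here bears on [IUTchIII]
Cor. 3.12; model-level ≠ node-level.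
-/

set_option autoImplicit false

namespace Literature.AnabelianGeometry.AbsoluteAnabelian.AbsTopIII

open CategoryTheory Quiver
open Literature.AnabelianGeometry.AbsoluteAnabelian.DiagramOfCategories

universe u

namespace BiAnabelianSetting

variable {X E N : Type u} [Category.{u} X] [Category.{u} E] [Category.{u} N]
  (𝔖 : BiAnabelianSetting X E N) (θ : FiberSquare.BiAnabelianLift 𝔖.gal)
  (hT : ∀ y : X, 𝔖.spaceGal.map (𝔖.iotaTimes.app y) = 𝔖.lamTimesGal.hom.app y ≫ 𝔖.lamTimesPfGal.inv.app y)
  (hL : ∀ A : X, 𝔖.spaceGal.map (𝔖.iotaLog.app A) =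
    𝔖.lamTimesGal.hom.app (𝔖.log.obj A) ≫ 𝔖.logGal.hom.app A ≫ 𝔖.lamTimesPfGal.inv.app A)

include θ hT hL

/-- **The glued family realises the whole (iii) collection**: the cores of (i), (ii), the observable `𝔖†_log`,
AND the telecore family `𝒥` of `𝔗_δ` (abc-iut-L4-t5's `RealisesCoresLogObsTele`).
[cite: MochizukiAbsTopIII2015, Cor 3.7 (iii) p.88] -/
theorem realisesCoresLogObsTele_glueLogFamily : 𝔖.RealisesCoresLogObsTele (𝔖.glueLogFamily hT hL) :=
  𝔖.realisesCoresLogObsTele_of_glueFamily_le (𝔖.glueLogFamily hT hL)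
    (fun _ _ _ _ h => 𝔖.glueFamily_sub_glueLogFamily hT hL h) (𝔖.realisesCoresAndLogObs_glueLogFamily hT hL).1 θ

/-- **[AbsTopIII] Cor 3.7 (iii), second clause — telecore half (`LogObsCompatTelecoreStmt`), under `ι` over
Galois** and over a bi-anabelian lift datum `θ` (for the telecore `𝔗_δ`).
[cite: MochizukiAbsTopIII2015, Cor 3.7 (iii) p.88] -/
theorem logObsCompatTelecoreStmt_of_iotaOverGal :
    Literature.AnabelianGeometry.AbsoluteAnabelian.AbsTopIII.BiAnabelianSetting.LogObsCompatTelecoreStmt 𝔖 :=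
  𝔖.logObsCompatTelecoreStmt_of_glueFamily_le θ (𝔖.glueLogFamily hT hL)
    (fun _ _ _ _ h => 𝔖.glueFamily_sub_glueLogFamily hT hL h) (𝔖.realisesCoresAndLogObs_glueLogFamily hT hL).1

/-- **[AbsTopIII] Cor 3.7 (iii), second clause — BOTH typed halves**, under (H×), (Hlog) and over `θ`.
[cite: MochizukiAbsTopIII2015, Cor 3.7 (iii) p.88] -/
theorem logObsCompat_of_iotaOverGal :
    Literature.AnabelianGeometry.AbsoluteAnabelian.AbsTopIII.BiAnabelianSetting.LogObsCompatCoresStmt 𝔖 ∧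
      Literature.AnabelianGeometry.AbsoluteAnabelian.AbsTopIII.BiAnabelianSetting.LogObsCompatTelecoreStmt 𝔖 :=
  𝔖.logObsCompat_of_glueFamily_le (𝔖.glueLogFamily hT hL)
    (fun _ _ _ _ h => 𝔖.glueFamily_sub_glueLogFamily hT hL h) (𝔖.realisesCoresAndLogObs_glueLogFamily hT hL).1 θ

end BiAnabelianSetting

end Literature.AnabelianGeometry.AbsoluteAnabelian.AbsTopIII
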